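import Summits.BirchSwinnertonDyer.BirchSwinnertonDyer.Theorems.PrintCf2RamifiedOffTYZSignCharacters
import Summits.BirchSwinnertonDyer.BirchSwinnertonDyer.Theorems.PrintCf2RamifiedOffTYZLowerHalfDoor
import Summits.BirchSwinnertonDyer.BirchSwinnertonDyer.Theorems.PrintCf2RamifiedOffTYZGenusCharacterRho
import HarnessLib

/-!
# Route `PrintCf2`, crux stmt-BirchSwinnertonDyer-20509 `RamifiedOffTYZOfFacts` — A HALF-MOVER EXISTS iff `ρ(n) = 1`: if the generator's
# abscissa `x(R)` is not in `{1, −1, n, −n}·ℚ^{×2}` then some `g ∈ Gal(ℍ′_n/K_n(i))` moves the half-generator `Q₁` (Galois theory on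
# `ℍ′_n ⊃ ℚ(i, √−n)`); hence **on the odd `s ≥ 2` class with such a generator, `2 ∣ 𝓛(n)`**, and on the odd jump-one class with such a
# generator **C⁺ ⟺ `P(n)` is moved by some element of `Gal(ℍ′_n/K_n(i))`**
# (cell `bsd-print-cf2`, LEAD of 20509 g11, line `offtyz-v7`, lineage cycle 12, sequel of `…LowerHalfDoor`; fact-free, Theses-free, no `def`)

HONEST FRAMING (crux 20509 = `𝔅_ram → WAllCornerFTwoRamifiedOffTYZProved`, DECIDING, OPEN AS A CLASS): bookkeeping on the displayed data
(`D : GenusPointData n`: the Galois number field `ℍ′_n ∋ i, √−n`), the W2 descent kernel (`Θ_E`, the explicit `2`-isogeny `φ`), Mathlib's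
Galois correspondence (`IsGalois.mem_bot_iff_fixed`), and the previous files of this seat (`…LowerHalfDoor`, `…GenusCharacterRho`) with THEIR
hypotheses (Thm 3.5, Lemma 3.18, g10's displays, Thm 1.1 by name, GZK).  Nothing is asserted; C⁺ = `stub_offTYZ_levelTwoScriptLExact` (= item
stmt-BirchSwinnertonDyer-23431) stays open.

Dictionary: `2^{ρ(n)} = [E_n(ℚ) : φ_n(A_n(ℚ)) + E_n[2]]` (TYZ §1) and the `x`-coordinate descent map (Silverman X.4.9: `(x,y) ↦ x mod ℚ^{×2}`,
kernel `φ_n(A_n(ℚ))`, `E_n[2] ↦ {1, −1, n, −n}`) give: `ρ(n) = 1` iff a generator `R` of `E_n(ℚ)` modulo torsion has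
`x(R) ∉ {1, −1, n, −n}·ℚ^{×2}`.  This file works with the latter, explicit form (no `rhoSubgroup` plumbing).

* (Galois input, `…SignCharacters`: a square root of a rational `ξ ∉ {±1, ±n}·ℚ^{×2}` is negated by some `g` fixing `i` and `√−n`.)
* §3 `exists_halfMover_of_x_not_mem`: for `R = (x, y) ∈ E_n(ℚ)` with `x ∉ {±1, ±n}·ℚ^{×2}` and any half `Q₁` of its twist (`φ_H(Q₁) = ι Θ_E(R)`):
  **some `g ∈ Aut_ℚ(ℍ′_n)` fixing `i`, `√−n` has `g·Q₁ ≠ Q₁`** (`Q₁ = (X₁, Y₁)`, `(Y₁/X₁)² = X(ι Θ_E R) = −4x/n`; negate `Y₁/X₁`).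
* §4 **`two_dvd_scriptL_of_x_not_mem_of_card_selmer_odd`**: `n = p₁⋯p_k` square-free odd, `n ≡ 5, 7 (mod 8)`, `r_an = 1`, GZK, the displays of
  g10's silence theorem + Thm 3.5 + Lemma 3.18, Thm 1.1 by name, `#Sel₂(E_n) = 2^{2+s}` with `s ≥ 2`, and a generator `R = (x,y)` of `E_n(ℚ)`
  modulo torsion with `x ∉ {±1, ±n}·ℚ^{×2}`: **`2 ∣ 𝓛(n)`** (every sign choice).  **`levelTwo_iff_exists_galPt_genusPoint_ne_of_x_not_mem`**: on the
  odd jump-one class (`#Sel₂ = 2⁵`) with such a generator, **C⁺ at `n` ⟺ some `g ∈ Aut_ℚ(ℍ′_n)` fixing `i`, `√−n` moves `P(n)`**.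
  And the complement (`…GenusCharacterRho`): with `ρ(n) = 0` no such `g` moves `P(n)` on the lower-half locus.

What this buys the line (LEAD census, crux 20509): the odd jump-one class (item 23431 restricted to odd `n`) is now split by the explicit,
per-`n` decidable descent bit «`x(R) ∈ {±1, ±n}·ℚ^{×2}`?»: where it FAILS (`ρ = 1`), the lower half of C⁺ is a theorem relative to the displays
and C⁺ itself is «`P(n) ∉ A(ℍ′_n)^{Gal(ℍ′_n/K_n(i))}`» — one Galois bit, BSD₂-predicted to be set; where it HOLDS (`ρ = 0`), nothing inside
`Gal(ℍ′_n/K_n(i))` sees C⁺.  Beyond-print theorem: the `ρ = 1` lower half (conditional on the displays, as g10).  C⁺ stays open; BSD is not proved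
by any of this; no class is closed by this file.

References: [cite: TianYuanZhang2017, §1 (p0002 L101–L110: ρ(n)), Thm. 3.5 (p0011 L94–L100), §3.1 (p0011 L27–L73), Lemma 3.16, Lemma 3.18,
Thm. 1.1]; [cite: SilvermanAEC2009, III.4.5, X.4.9]; [cite: HeathBrown1994SelmerCongruentII, Appendix (Monsky)]; [cite: Darmon2004, Thm. 3.22];
tree: `…LowerHalfDoor`, `…GenusCharacterRho`, `…GenusCharacter`, `…MoverCoordinates` (sign-bit lemmas), W2 kernel `GenusDescentTwist` (`ΘE_some`).
-/

noncomputable section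

open scoped Classical

open WeierstrassCurve WeierstrassCurve.Affine Literature.NumberTheory.EllipticCurves
  Literature.NumberTheory.EllipticCurves.Rank1Residual Summit.BirchSwinnertonDyer.Rank1Residual
  Literature.NumberTheory.EllipticCurves.TianYuanZhang2017
  Literature.NumberTheory.EllipticCurves.TianYuanZhang2017.W2
  Summit.BirchSwinnertonDyer.PrintCf2.LevelTwoHalfGenerator
  Summit.BirchSwinnertonDyer.PrintCf2.GaloisMotion
  Summit.BirchSwinnertonDyer.PrintCf2.LevelTwoHalves
  Summit.BirchSwinnertonDyer.PrintCf2.LevelTwoGenusQuotient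
  Summit.BirchSwinnertonDyer.PrintCf2.GenusCharacter
  Summit.BirchSwinnertonDyer.PrintCf2.GenusCharacterRho
  Summit.BirchSwinnertonDyer.PrintCf2.LowerHalfDoor
  Summit.BirchSwinnertonDyer.PrintCf2.MoverAssembly
  Summit.BirchSwinnertonDyer.PrintCf2.SignCharacters
  Summit.BirchSwinnertonDyer.Rank1Residual.P2.ThetaDescent

set_option autoImplicit false

namespace Summit.BirchSwinnertonDyer.PrintCf2.HalfMover

variable {n : ℕ}

/-! ## §3 A half-mover exists when `x(R) ∉ {±1, ±n}·ℚ^{×2}` -/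

/-- **HALF-MOVER EXISTENCE.**  Square-free `n`; `R = (x, y) ∈ E_n(ℚ)` with `x ∉ {1, −1, n, −n}·ℚ^{×2}` (equivalently `ρ(n) = 1` when `R` generates
`E_n(ℚ)` modulo torsion); `Q₁ ∈ A(ℍ′_n)` any half of its twist (`φ_H(Q₁) = ι Θ_E(R)`).  Then some `g ∈ Aut_ℚ(ℍ′_n)` fixing `i` and `√−n` has
`g·Q₁ ≠ Q₁`.  (`Q₁ = (X₁, Y₁)` with `(Y₁/X₁)² = X(ι Θ_E R) = −4x/n`; §2 negates `Y₁/X₁`.)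
[cite: TianYuanZhang2017, §1 (p0002 L101–L110), §3.1 (p0011 L27–L36)] [cite: SilvermanAEC2009, III.4.5, X.4.9] -/
theorem exists_halfMover_of_x_not_mem (hsq : Squarefree n) [(congruentNumberCurve n).IsElliptic] (D : GenusPointData n)
    {x y : ℚ} (h : (congruentNumberCurve n).toAffine.Nonsingular x y)
    (hx : ¬ ∃ q : ℚ, x = q ^ 2 ∨ x = -q ^ 2 ∨ x = n * q ^ 2 ∨ x = -(n * q ^ 2))
    {Q₁ : APoint D.H} (hQ₁ : φH D Q₁ = Point.map (W' := curveA.twoIsogenyCodomain)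
      (D.embK n (Nat.mem_divisors_self n hsq.ne_zero)) (ΘE hsq.ne_zero (.some x y h))) :
    ∃ g : D.H ≃ₐ[ℚ] D.H, g D.im = D.im ∧ g (D.sqrtNeg n) = D.sqrtNeg n ∧ D.galPt g Q₁ ≠ Q₁ := by
  have hn0 : n ≠ 0 := hsq.ne_zero
  have hn : n ∈ n.divisors := Nat.mem_divisors_self n hn0
  have hnQ : (n : ℚ) ≠ 0 := by exact_mod_cast hn0
  obtain ⟨h₃, e₃⟩ := ΘE_some hn0 h
  have hθ : D.embK n hn (θn n) = D.sqrtNeg n := AdjoinRoot.liftAlgHom_root _ _ _ _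
  have hs : D.sqrtNeg n ^ 2 = -(n : D.H) := D.sqrtNeg_sq n hn
  -- `Q₁` is an affine point with `X₁ ≠ 0`
  rcases Q₁ with _ | ⟨X₁, Y₁, hQ⟩
  · exfalso
    rw [← Point.zero_def, map_zero, e₃, Point.map_some] at hQ₁
    exact Point.some_ne_zero _ hQ₁.symm
  have hX0 : X₁ ≠ 0 := by
    intro hX
    have : φH D (.some X₁ Y₁ hQ) = 0 := twoIsogenyPointsHom_some_of_eq_zero curveA hQ hX
    rw [this, e₃, Point.map_some] at hQ₁
    exact Point.some_ne_zero _ hQ₁.symm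
  obtain ⟨h', eφ⟩ := twoIsogenyPointsHom_some curveA hQ hX0
  have hX : (curveA.baseChange D.H).twoIsogenyX X₁ = D.embK n hn ((θn n ^ 2)⁻¹ * algebraMap ℚ (GenusField n) (4 * x)) := by
    have := hQ₁
    rw [show φH D (.some X₁ Y₁ hQ) = curveA.twoIsogenyPointsHom D.H (.some X₁ Y₁ hQ) from rfl, eφ, e₃, Point.map_some,
      Point.some.injEq] at this
    exact this.1
  obtain ⟨-, h2, -, h4, -⟩ := curveA_baseChange_a (H := D.H)
  have heq : Y₁ ^ 2 = X₁ ^ 3 + 4 * X₁ := (curveA_nonsingular_iff X₁ Y₁).mp hQ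
  -- `w = Y₁/X₁`, `w² = −4x/n`
  set w : D.H := Y₁ / X₁ with hw
  have hw2 : w ^ 2 = algebraMap ℚ D.H (-(4 * x) / n) := by
    have e1 : w ^ 2 = (curveA.baseChange D.H).twoIsogenyX X₁ := by
      rw [twoIsogenyX, h2, h4, hw, div_pow, div_eq_div_iff (pow_ne_zero 2 hX0) hX0]
      linear_combination X₁ * heq
    rw [e1, hX, map_mul, map_inv₀, map_pow, hθ, AlgHom.commutes, hs, map_div₀, map_neg, map_natCast]
    field_simp
  have hξ : ¬ ∃ q : ℚ, -(4 * x) / n = q ^ 2 ∨ -(4 * x) / n = -q ^ 2 ∨ -(4 * x) / n = n * q ^ 2 ∨ -(4 * x) / n = -(n * q ^ 2) := by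
    rintro ⟨q, hq | hq | hq | hq⟩ <;> apply hx <;> have hq' := (div_eq_iff hnQ).mp hq
    · exact ⟨q / 2, Or.inr (Or.inr (Or.inr (by linear_combination (-1 / 4 : ℚ) * hq')))⟩
    · exact ⟨q / 2, Or.inr (Or.inr (Or.inl (by linear_combination (-1 / 4 : ℚ) * hq')))⟩
    · exact ⟨n * q / 2, Or.inr (Or.inl (by linear_combination (-1 / 4 : ℚ) * hq'))⟩
    · exact ⟨n * q / 2, Or.inl (by linear_combination (-1 / 4 : ℚ) * hq')⟩
  obtain ⟨g, hgi, hgK, hgw⟩ := exists_algEquiv_apply_eq_neg_of_sq_eq D hn hw2 hξ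
  refine ⟨g, hgi, hgK, fun hfix => ?_⟩
  rw [GenusPointData.galPt, Point.map_some, Point.some.injEq] at hfix
  obtain ⟨h1, h2'⟩ := hfix
  have h1' : g X₁ = X₁ := h1
  have h2'' : g Y₁ = Y₁ := h2'
  have hgw' : g w = w := by rw [hw, map_div₀, h1', h2'']
  have hw0 : w ≠ 0 := by
    intro h0
    rw [h0, zero_pow two_ne_zero, eq_comm, map_eq_zero, div_eq_zero_iff] at hw2
    rcases hw2 with h0' | h0'
    · apply hx; exact ⟨0, Or.inl (by linear_combination (-1 / 4 : ℚ) * h0')⟩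
    · exact hnQ h0'
  rw [hgw'] at hgw
  exact hw0 (eq_zero_of_eq_neg' hgw)

/-! ## §4 The lower half on `{ρ(n) = 1}`, and C⁺ as one Galois bit -/

open Finset Matrix Literature.NumberTheory.EllipticCurves.HeathBrown1994 Literature.NumberTheory.EllipticCurves.Smith2016
  Literature.NumberTheory.QuadraticFields.RingClass Literature.NumberTheory.QuadraticFields
  Summit.BirchSwinnertonDyer.PrintCf2.QForm Summit.BirchSwinnertonDyer.PrintCf2.QFormForest
  Summit.BirchSwinnertonDyer.PrintCf2.LayerOneSilence Summit.BirchSwinnertonDyer.PrintCf2.LayerOneSilenceOdd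

variable {k : ℕ} (p : Fin k → ℕ) (hp : ∀ i, (p i).Prime) (hpodd : ∀ i, Odd (p i)) (hinj : Function.Injective p)
variable (D : GenusPointData n)

include hp hpodd hinj in
/-- **ON THE ODD `s ≥ 2` CLASS, A GENERATOR WITH `x(R) ∉ {±1, ±n}·ℚ^{×2}` FORCES `2 ∣ 𝓛(n)`.**  `n = p₁⋯p_k` square-free, `n ≡ 5` or `7 (mod 8)`,
`ord_{s=1} L(E_n, s) = 1`, GZK; the displayed recursion, sign choices, Thm 3.5 main clause, Lemma 3.18, the CM-point blocks, conductor-2 ring class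
dictionary and Frobenius clause (g10's hypotheses verbatim); Thm 1.1 BY NAME; `#Sel₂(E_n/ℚ) = 2^{2+s}`, `s ≥ 2`; `R = (x, y)` a generator of `E_n(ℚ)`
modulo torsion with `x ∉ {1, −1, n, −n}·ℚ^{×2}`.  Then `2 ∣ L` for every integer `L` with `𝓛(n)² = L²`.
[cite: TianYuanZhang2017, Thm. 3.5 (p0011 L94–L100), §3.1 (p0011 L53–L73), Thm. 3.6 (1), proof of Lemma 3.21 (p0020 L27–L63), Thm. 1.1, §1 (p0002 L101–L110)]
[cite: HeathBrown1994SelmerCongruentII, Appendix (Monsky), typescript p. 39 L10–L41] [cite: Darmon2004, Thm. 3.22] -/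
theorem two_dvd_scriptL_of_x_not_mem_of_card_selmer_odd
    (hGZK : rank_eq_analyticRank_of_analyticRank_le_one) (hsqf : Squarefree n) (hn : n = ∏ i, p i)
    (h57 : n % 8 = 5 ∨ n % 8 = 7) (hr : (congruentNumberCurve n).analyticRank = 1)
    (hrec : D.recursion) (hLs : D.scriptLSpec) (h35 : D.thm35Main) (h318 : D.lemma318)
    (z : ℕ → APoint D.H) (Φ : ℕ → Finset (D.H ≃ₐ[ℚ] D.H)) (ΓH ΓH' : ℕ → Subgroup (D.H ≃ₐ[ℚ] D.H))
    (σ : ℕ → (D.H ≃ₐ[ℚ] D.H)) (c : D.H ≃ₐ[ℚ] D.H) (ρ : (d : ℕ) → (D.galK d →* RingClassGroup (GenusField d) 2))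
    (hc : D.ConjSpec c)
    (hblock : ∀ d ∈ n.divisors, ((d % 8 = 5 ∨ d % 8 = 6) → D.CMBlockSpec d (z d) (Φ d) (ΓH d) (ΓH' d) (σ d) c) ∧
      (d % 8 = 7 → D.SevenBlockSpec d))
    (hring : ∀ d ∈ n.divisors, d % 8 = 5 → D.RingClassTwoBlockSpec d (ΓH d) (ΓH' d) (ρ d))
    (hFrob : ∀ d ∈ n.divisors, d % 8 = 5 → ∀ q : ℕ, q.Prime → q ∣ d → ∃ φ : D.H ≃ₐ[ℚ] D.H,
      φ (D.sqrtNeg d) = D.sqrtNeg d ∧ φ * φ ∈ ΓH' d ∧ φ D.im = (jacobiSym (-1) q) • D.im ∧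
        ∀ r : ℕ, r.Prime → r ∣ n → r ≠ q → φ (D.sqrtNeg r) = (jacobiSym (-(r : ℤ)) q) • D.sqrtNeg r)
    (h11 : thm11_parity_of_scriptL) {s : ℕ} (hs : 2 ≤ s)
    (hsel : Nat.card ((congruentNumberCurve n).selmerGroup 2) = 2 ^ (2 + s))
    {x y : ℚ} (hxy : (congruentNumberCurve n).toAffine.Nonsingular x y)
    (hR : ∀ P, ∃ m : ℤ, IsOfFinAddOrder (P - m • (Point.some x y hxy : (congruentNumberCurve n).toAffine.Point)))
    (hx : ¬ ∃ q : ℚ, x = q ^ 2 ∨ x = -q ^ 2 ∨ x = n * q ^ 2 ∨ x = -(n * q ^ 2)) :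
    ∀ L : ℤ, IsScriptL n L → (2 : ℤ) ∣ L := by
  haveI := isElliptic_congruentNumberCurve hsqf.ne_zero
  have hnd : n ∈ n.divisors := Nat.mem_divisors_self n hsqf.ne_zero
  obtain ⟨Q₁, hQ₁⟩ := twist_halving hsqf hnd D (.some x y hxy)
  obtain ⟨g₀, hgi, hgK, hmove⟩ := exists_halfMover_of_x_not_mem hsqf D hxy hx hQ₁
  exact two_dvd_scriptL_of_halfMover_of_card_selmer_odd p hp hpodd hinj D hGZK hsqf hn h57 hr hrec hLs h35 h318 z Φ ΓH ΓH' σ c ρ hc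
    hblock hring hFrob h11 hs hsel hR hQ₁ g₀ hgi hgK hmove

include hp hpodd hinj in
/-- **ON THE ODD JUMP-ONE CLASS WITH `x(R) ∉ {±1, ±n}·ℚ^{×2}`, C⁺ IS «`P(n)` IS MOVED BY `Gal(ℍ′_n/K_n(i))`».**  Same data with `#Sel₂(E_n/ℚ) = 2⁵`:
the conclusion of C⁺ at `n` (`2 ∣ L ∧ 4 ∤ L` for every sign choice) holds **iff some `g ∈ Aut_ℚ(ℍ′_n)` fixing `i` and `√−n` has `g·P(n) ≠ P(n)`.**
[cite: TianYuanZhang2017, Thm. 3.5 (p0011 L94–L100), §3.1 (p0011 L53–L73), Thm. 3.6 (1), Thm. 1.1, §1 (p0002 L101–L110)]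
[cite: HeathBrown1994SelmerCongruentII, Appendix (Monsky), typescript p. 39 L10–L41] [cite: Darmon2004, Thm. 3.22] -/
theorem levelTwo_iff_exists_galPt_genusPoint_ne_of_x_not_mem
    (hGZK : rank_eq_analyticRank_of_analyticRank_le_one) (hsqf : Squarefree n) (hn : n = ∏ i, p i)
    (h57 : n % 8 = 5 ∨ n % 8 = 7) (hr : (congruentNumberCurve n).analyticRank = 1)
    (hrec : D.recursion) (hLs : D.scriptLSpec) (h35 : D.thm35Main) (h318 : D.lemma318)
    (z : ℕ → APoint D.H) (Φ : ℕ → Finset (D.H ≃ₐ[ℚ] D.H)) (ΓH ΓH' : ℕ → Subgroup (D.H ≃ₐ[ℚ] D.H))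
    (σ : ℕ → (D.H ≃ₐ[ℚ] D.H)) (c : D.H ≃ₐ[ℚ] D.H) (ρ : (d : ℕ) → (D.galK d →* RingClassGroup (GenusField d) 2))
    (hc : D.ConjSpec c)
    (hblock : ∀ d ∈ n.divisors, ((d % 8 = 5 ∨ d % 8 = 6) → D.CMBlockSpec d (z d) (Φ d) (ΓH d) (ΓH' d) (σ d) c) ∧
      (d % 8 = 7 → D.SevenBlockSpec d))
    (hring : ∀ d ∈ n.divisors, d % 8 = 5 → D.RingClassTwoBlockSpec d (ΓH d) (ΓH' d) (ρ d))
    (hFrob : ∀ d ∈ n.divisors, d % 8 = 5 → ∀ q : ℕ, q.Prime → q ∣ d → ∃ φ : D.H ≃ₐ[ℚ] D.H,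
      φ (D.sqrtNeg d) = D.sqrtNeg d ∧ φ * φ ∈ ΓH' d ∧ φ D.im = (jacobiSym (-1) q) • D.im ∧
        ∀ r : ℕ, r.Prime → r ∣ n → r ≠ q → φ (D.sqrtNeg r) = (jacobiSym (-(r : ℤ)) q) • D.sqrtNeg r)
    (h11 : thm11_parity_of_scriptL)
    (hsel : Nat.card ((congruentNumberCurve n).selmerGroup 2) = 2 ^ 5)
    {x y : ℚ} (hxy : (congruentNumberCurve n).toAffine.Nonsingular x y)
    (hR : ∀ P, ∃ m : ℤ, IsOfFinAddOrder (P - m • (Point.some x y hxy : (congruentNumberCurve n).toAffine.Point)))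
    (hx : ¬ ∃ q : ℚ, x = q ^ 2 ∨ x = -q ^ 2 ∨ x = n * q ^ 2 ∨ x = -(n * q ^ 2)) :
    (∀ L : ℤ, IsScriptL n L → (2 : ℤ) ∣ L ∧ ¬ (4 : ℤ) ∣ L) ↔
      ∃ g : D.H ≃ₐ[ℚ] D.H, g D.im = D.im ∧ g (D.sqrtNeg n) = D.sqrtNeg n ∧ D.galPt g (D.P n) ≠ D.P n := by
  haveI := isElliptic_congruentNumberCurve hsqf.ne_zero
  have hnd : n ∈ n.divisors := Nat.mem_divisors_self n hsqf.ne_zero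
  obtain ⟨Q₁, hQ₁⟩ := twist_halving hsqf hnd D (.some x y hxy)
  obtain ⟨g₀, hgi, hgK, hmove⟩ := exists_halfMover_of_x_not_mem hsqf D hxy hx hQ₁
  have h2 := two_dvd_scriptL_of_halfMover_of_card_selmer_odd p hp hpodd hinj D hGZK hsqf hn h57 hr hrec hLs h35 h318 z Φ ΓH ΓH' σ c ρ hc
    hblock hring hFrob h11 (s := 3) (by norm_num) (by rw [hsel]) hR hQ₁ g₀ hgi hgK hmove
  exact GenusCharacterRho.levelTwo_iff_exists_galPt_genusPoint_ne_of_two_dvd hGZK hsqf h57 hr D h35 hLs h318 hR hQ₁ h2 hgi hgK hmove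

end Summit.BirchSwinnertonDyer.PrintCf2.HalfMover

end
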